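import Summits.CriticalPhenomena.PercolationContinuityZ3.Theorems.Transplant.CayleyQuotientCriticalProb
import Literature.Probability.Percolation.CubicSiteCriticalProbTriangularStrict
import Mathlib.GroupTheory.QuotientGroup.Defs
import HarnessLib

/-!
# `p_c` STRICTLY increases under quotients of the group: `p_c(Cay(Γ; S), g) < p_c(Cay(Q; π(S)), π g)` for every surjection
# `π : Γ ↠ Q` with non-trivial kernel and every finite generating `S` with `p_c(Cay(Γ; S)) < 1` — Benjamini–Schramm's Question 1
# for Cayley graphs, by Martineau–Severo's Corollary 2.2 (kernel theorem of the tree); bond AND site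

builds on p205010 (kernel theorem, internal audit signed; external expert review pending) — nothing in this file uses p205010; unconditional, no node.
Lane `prim-bschramm`, seat `prim-bschramm-p3` gen 37 (offer O15, file F-SI1).  Helper file (`--supports stmt-CriticalPhenomena-4575 --as helper`).
Sequel of «CayleyQuotientCriticalProb» (p4 g23: the WEAK half `CayleyQuot.criticalProb_le`, `p_c(Cay(Γ; S), g) ≤ p_c(Cay(Q; π(S)), π g)`,
Benjamini–Schramm Thm. 1 / Lyons–Peres Thm. 6.47).

THE POINT.  Benjamini–Schramm 1996, Question 1: for a quasi-transitive `𝒢` with `p_c(𝒢) < 1` and a non-trivial group `G` acting FREELY on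
`V(𝒢)` with quasi-transitive quotient `𝒢/G`, is `p_c(𝒢) < p_c(𝒢/G)`?  Martineau–Severo 2019 answer YES (their Corollary 2.2), and the tree holds
that corollary as a KERNEL theorem (`MartineauSevero2019_cor22_holds`, «CoveringStrictMonotonicityHolds»; site twin
`MartineauSevero2019_cor22_site_holds`).  The archetype of the question is a GROUP QUOTIENT: the kernel `K = ker π` of a surjection `π : Γ ↠ Q`
acts on the right Cayley graph `Cay(Γ; S) = mulCayley ↑S` by LEFT multiplication — by automorphisms (`ker_isActionByAut`), freely (`ker_free`),
non-trivially iff `ker π ≠ ⊥` —, its orbits are the fibres of `π` (`qmk_ker_eq_iff`), and the orbit quotient graph IS the quotient Cayley graph: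
**`quotKerIso π hπ S : orbitQuotientGraph (mulCayley ↑S) ↥(ker π) ≃g mulCayley ↑(S.image π)`** (generators in the kernel become loops and
disappear — Mathlib's `mulCayley` has no loops; the push-forward `S.image π` is taken w.r.t. the ambient `DecidableEq Q`).  Both graphs are
transitive.  Hence
**`CayleyQuot.criticalProb_lt`**: `π` surjective, `ker π ≠ ⊥`, `closure S = ⊤`, `p_c(Cay(Γ; S), g) < 1` ⟹
`p_c(Cay(Γ; S), g) < p_c(Cay(Q; π(S)), π g)`; the normal-subgroup spelling **`criticalProb_lt_quotientGroup`** (`N ⊴ Γ`, `N ≠ ⊥`,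
`Q = Γ ⧸ N`); and the SITE twins **`siteCriticalProb_lt`**, **`siteCriticalProb_lt_quotientGroup`**.  One `def` (the isomorphism), no instance,
no notation.  Customer (F-SI2, «GrigorchukLamplighterStrictInequality»): `p_c(Cay(ℤ ≀_X 𝔊; a,b,c,d,s)) < p_c(Cay(𝔊; a,b,c,d))`.
[cite: MartineauSevero2019, Cor. 2.2; §1 Question 1.1 (Benjamini–Schramm) and the abstract] [cite: BenjaminiSchramm1996, Question 1; Thm. 1]
[cite: LyonsPeres2016, Thm. 6.47]
-/

noncomputable section

namespace Summit.CriticalPhenomena.PercolationContinuityZ3.Theorems.Transplant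
open SimpleGraph Literature.Probability.LatticeModels Literature.Probability.Percolation
open Literature.Barriers.CriticalPhenomena (countable_of_connected_of_locallyFinite IsQuasiTransitive)
open scoped Classical

namespace CayleyQuot

variable {Γ Q : Type} [Group Γ] [Group Q]

/-! ## §1 The kernel acts on `Cay(Γ; S)` by left multiplication: by automorphisms, freely, with the fibres of `π` as orbits -/

/-- The action of the subgroup `ker π` on `Γ` is left multiplication (Mathlib's subgroup action). [folklore] -/
theorem ker_smul_def (π : Γ →* Q) (k : ↥π.ker) (g : Γ) : k • g = (k : Γ) * g := rfl

/-- **Left multiplication by the kernel is an action by automorphisms of the right Cayley graph** (for ANY `S`).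
[cite: MartineauSevero2019, Cor. 2.2 (hypothesis "acting by graph automorphisms")] [cite: BenjaminiSchramm1996, §2 (Cayley graphs)] -/
theorem ker_isActionByAut (π : Γ →* Q) (S : Finset Γ) : IsActionByAut (mulCayley (↑S : Set Γ)) ↥π.ker := fun k x y => by
  rw [ker_smul_def, ker_smul_def]; exact mulCayley_adj_mul_iff_right

/-- **The action is free.** [cite: MartineauSevero2019, Cor. 2.2 (hypothesis "the action is free")] -/
theorem ker_free (π : Γ →* Q) (k : ↥π.ker) (g : Γ) (h : k • g = g) : k = 1 := by
  rw [ker_smul_def] at h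
  exact Subtype.ext (mul_eq_right.1 h)

/-- The kernel is a non-trivial group iff it is not `⊥`. [folklore] -/
theorem ker_nontrivial (π : Γ →* Q) (hker : π.ker ≠ ⊥) : Nontrivial ↥π.ker := (Subgroup.nontrivial_iff_ne_bot _).2 hker

/-- **The orbits of the kernel are the fibres of `π`**: `⟦x⟧ = ⟦y⟧ ↔ π x = π y`. [folklore] -/
theorem qmk_ker_eq_iff (π : Γ →* Q) (x y : Γ) : qmk ↥π.ker x = qmk ↥π.ker y ↔ π x = π y := by
  rw [qmk_eq_iff]
  constructor
  · rintro ⟨k, rfl⟩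
    rw [ker_smul_def, map_mul, (MonoidHom.mem_ker).1 k.2, one_mul]
  · intro h
    refine ⟨⟨x * y⁻¹, (MonoidHom.mem_ker).2 (by rw [map_mul, map_inv, h, mul_inv_cancel])⟩, ?_⟩
    rw [ker_smul_def, inv_mul_cancel_right]

/-! ## §2 The orbit quotient graph IS the quotient Cayley graph -/

variable [DecidableEq Q]

/-- `π` is a contraction of Cayley graphs: adjacent vertices of `Cay(Γ; S)` have equal or adjacent images in `Cay(Q; π(S))`. [cite: LyonsPeres2016, §6.9 (weak covering maps)] -/
theorem map_adj_or_eq (π : Γ →* Q) (S : Finset Γ) {x y : Γ} (h : (mulCayley (↑S : Set Γ)).Adj x y) :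
    π x = π y ∨ (mulCayley (↑(S.image π) : Set Q)).Adj (π x) (π y) := by
  by_cases he : π x = π y
  · exact Or.inl he
  · right
    rw [mulCayley_adj'] at h ⊢
    obtain ⟨-, s, hs, hxy⟩ := h
    refine ⟨he, π s, Finset.mem_coe.2 (Finset.mem_image_of_mem π (Finset.mem_coe.1 hs)), ?_⟩
    rcases hxy with hxy | hxy
    · exact Or.inl (by rw [← map_mul, hxy])
    · exact Or.inr (by rw [← map_mul, ← hxy])

/-- **THE ISOMORPHISM `ker π \ Cay(Γ; S) ≅ Cay(Q; π(S))`** induced by `π` on the orbits (well defined and injective by `qmk_ker_eq_iff`, onto by the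
surjectivity of `π`; adjacency: `π` is a weak covering — `map_adj_or_eq` down, edge lifting up, cf. «CayleyQuotientCriticalProb» `surjOn_neighborSet`).
[cite: MartineauSevero2019, §1 (the quotient graph 𝒢/G; Question 1.1)] [cite: BenjaminiSchramm1996, Question 1 (G/Γ for Γ a normal subgroup)] -/
def quotKerIso (π : Γ →* Q) (hπ : Function.Surjective π) (S : Finset Γ) :
    orbitQuotientGraph (mulCayley (↑S : Set Γ)) ↥π.ker ≃g mulCayley (↑(S.image π) : Set Q) where
  toFun := Quotient.lift π fun a b hab => by
    obtain ⟨k, rfl⟩ := MulAction.orbitRel_apply.1 hab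
    change π (k • b) = π b
    rw [ker_smul_def, map_mul, (MonoidHom.mem_ker).1 k.2, one_mul]
  invFun := fun q => qmk ↥π.ker (Function.surjInv hπ q)
  left_inv := fun a => Quotient.inductionOn' a fun x => by
    show qmk ↥π.ker (Function.surjInv hπ (π x)) = qmk ↥π.ker x
    rw [qmk_ker_eq_iff, Function.surjInv_eq hπ]
  right_inv := fun q => by
    show π (Function.surjInv hπ q) = q
    exact Function.surjInv_eq hπ q
  map_rel_iff' := by
    intro a b
    induction a using Quotient.inductionOn' with
    | h x =>
    induction b using Quotient.inductionOn' with
    | h y =>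
    show (mulCayley (↑(S.image π) : Set Q)).Adj (π x) (π y) ↔ (orbitQuotientGraph (mulCayley (↑S : Set Γ)) ↥π.ker).Adj (qmk ↥π.ker x) (qmk ↥π.ker y)
    rw [quot_adj_iff (ker_isActionByAut π S)]
    constructor
    · intro h
      refine ⟨fun he => h.ne ((qmk_ker_eq_iff π x y).1 he), ?_⟩
      -- lift the edge `π x ∼ π y` to an edge `x ∼ z` with `π z = π y`, then `z = k • y`
      obtain ⟨hne, q, hq, hxy⟩ := (mulCayley_adj' _ _ _).1 h
      obtain ⟨s, hs, rfl⟩ := Finset.mem_image.1 (Finset.mem_coe.1 hq)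
      have hs1 : s ≠ 1 := by
        rintro rfl
        rw [map_one, mul_one, mul_one] at hxy
        rcases hxy with e | e
        · exact hne e
        · exact hne e
      have lift : ∀ z : Γ, π z = π y → (mulCayley (↑S : Set Γ)).Adj x z → ∃ k : ↥π.ker, (mulCayley (↑S : Set Γ)).Adj x (k • y) := by
        intro z hz hxz
        obtain ⟨k, hk⟩ := (qmk_eq_iff ↥π.ker z y).1 ((qmk_ker_eq_iff π z y).2 hz)
        exact ⟨k, by rw [hk]; exact hxz⟩
      rcases hxy with e | e
      · refine lift (x * s) (by rw [map_mul, e]) ((mulCayley_adj' _ _ _).2 ⟨fun h' => hs1 ?_, s, hs, Or.inl rfl⟩)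
        exact mul_eq_left.1 h'.symm
      · refine lift (x * s⁻¹) (by rw [map_mul, map_inv, e, mul_inv_cancel_right])
          ((mulCayley_adj' _ _ _).2 ⟨fun h' => hs1 ?_, s, hs, Or.inr (by rw [inv_mul_cancel_right])⟩)
        exact inv_eq_one.1 (mul_eq_left.1 h'.symm)
    · rintro ⟨hne, k, hk⟩
      have hky : π (k • y) = π y := by rw [ker_smul_def, map_mul, (MonoidHom.mem_ker).1 k.2, one_mul]
      rcases map_adj_or_eq π S hk with h | h
      · exact absurd ((qmk_ker_eq_iff π x y).2 (h.trans hky)) hne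
      · rwa [hky] at h

/-- `quotKerIso ⟦x⟧ = π x`. [folklore] -/
@[simp] theorem quotKerIso_qmk (π : Γ →* Q) (hπ : Function.Surjective π) (S : Finset Γ) (x : Γ) :
    quotKerIso π hπ S (qmk ↥π.ker x) = π x := rfl

/-- **The quotient `ker π \ Cay(Γ; S)` is quasi-transitive** (indeed transitive: it is `Cay(Q; π(S))`).
[cite: MartineauSevero2019, Cor. 2.2 (hypothesis "ℋ is quasi-transitive"); §3 Remark 2 (G normal in a quasi-transitive group)] -/
theorem isQuasiTransitive_quotKer (π : Γ →* Q) (hπ : Function.Surjective π) (S : Finset Γ) :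
    IsQuasiTransitive (orbitQuotientGraph (mulCayley (↑S : Set Γ)) ↥π.ker) :=
  CubicTriStrict.isQuasiTransitive_of_iso (quotKerIso π hπ S) (CayleyScaled.isQuasiTransitive_mulCayley (S.image π))

/-! ## §3 Benjamini–Schramm's Question 1 for group quotients: the STRICT inequalities -/

/-- **`p_c(Cay(Γ; S), g) < p_c(Cay(Q; π(S)), π g)` — STRICTLY** — for every surjection `π : Γ ↠ Q` with NON-TRIVIAL kernel, every finite
GENERATING `S` and every vertex `g` with `p_c(Cay(Γ; S), g) < 1`: Martineau–Severo's Corollary 2.2 (tree KERNEL theorem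
`MartineauSevero2019_cor22_holds`) for the free left action of `ker π`, read through `quotKerIso`.  (All four hypotheses of Cor. 2.2 are needed in
general, M–S §3; here freeness and both transitivities are automatic, `p_c < 1` and `ker π ≠ ⊥` are the binders.)
[cite: MartineauSevero2019, Cor. 2.2; abstract] [cite: BenjaminiSchramm1996, Question 1] -/
theorem criticalProb_lt (π : Γ →* Q) (hπ : Function.Surjective π) (hker : π.ker ≠ ⊥) (S : Finset Γ)
    (hS : Subgroup.closure (↑S : Set Γ) = ⊤) (g : Γ) (hpc : criticalProb (mulCayley (↑S : Set Γ)) g < 1) :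
    criticalProb (mulCayley (↑S : Set Γ)) g < criticalProb (mulCayley (↑(S.image π) : Set Q)) (π g) := by
  have hc : (mulCayley (↑S : Set Γ)).Connected := CayleyScaled.connected_mulCayley_of_closure S hS
  haveI : Countable Γ := countable_of_connected_of_locallyFinite _ hc g
  haveI : Countable Q := hπ.countable
  have h := MartineauSevero2019_cor22_holds Γ (mulCayley (↑S : Set Γ)) ↥π.ker (ker_nontrivial π hker) (ker_isActionByAut π S)
    (ker_free π) hc (CayleyScaled.isQuasiTransitive_mulCayley S) (isQuasiTransitive_quotKer π hπ S) g hpc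
  rw [← criticalProb_iso (quotKerIso π hπ S) (qmk ↥π.ker g)] at h
  simpa only [quotKerIso_qmk] using h

/-- **SITE twin: `p_c^{site}(Cay(Γ; S), g) < p_c^{site}(Cay(Q; π(S)), π g)`** under `p_c^{site}(Cay(Γ; S), g) < 1` (Martineau–Severo Cor. 2.2, site
version, tree theorem `MartineauSevero2019_cor22_site_holds`). [cite: MartineauSevero2019, Cor. 2.2 (site percolation, §1 "our results hold for site percolation")]
[cite: BenjaminiSchramm1996, Question 1] -/
theorem siteCriticalProb_lt (π : Γ →* Q) (hπ : Function.Surjective π) (hker : π.ker ≠ ⊥) (S : Finset Γ)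
    (hS : Subgroup.closure (↑S : Set Γ) = ⊤) (g : Γ) (hpc : siteCriticalProb (mulCayley (↑S : Set Γ)) g < 1) :
    siteCriticalProb (mulCayley (↑S : Set Γ)) g < siteCriticalProb (mulCayley (↑(S.image π) : Set Q)) (π g) := by
  have hc : (mulCayley (↑S : Set Γ)).Connected := CayleyScaled.connected_mulCayley_of_closure S hS
  haveI : Countable Γ := countable_of_connected_of_locallyFinite _ hc g
  haveI : Countable Q := hπ.countable
  have h := MartineauSevero2019_cor22_site_holds Γ (mulCayley (↑S : Set Γ)) ↥π.ker (ker_nontrivial π hker) (ker_isActionByAut π S)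
    (ker_free π) hc (CayleyScaled.isQuasiTransitive_mulCayley S) (isQuasiTransitive_quotKer π hπ S) g hpc
  rw [← CubicTriSiteStrict.siteCriticalProb_iso (quotKerIso π hπ S) (qmk ↥π.ker g)] at h
  simpa only [quotKerIso_qmk] using h

/-! ## §4 The normal-subgroup spelling `Γ ↠ Γ ⧸ N` -/

/-- **`p_c(Cay(Γ; S), g) < p_c(Cay(Γ ⧸ N; S̄), ḡ)` for every NON-TRIVIAL NORMAL subgroup `N`** (finite generating `S`, `p_c(Cay(Γ; S), g) < 1`) —
Benjamini–Schramm's Question 1 in its original Cayley-graph form. [cite: BenjaminiSchramm1996, Question 1] [cite: MartineauSevero2019, Cor. 2.2; abstract] -/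
theorem criticalProb_lt_quotientGroup (N : Subgroup Γ) [N.Normal] (hN : N ≠ ⊥) (S : Finset Γ) (hS : Subgroup.closure (↑S : Set Γ) = ⊤)
    (g : Γ) (hpc : criticalProb (mulCayley (↑S : Set Γ)) g < 1) :
    criticalProb (mulCayley (↑S : Set Γ)) g <
      criticalProb (mulCayley (↑(S.image (QuotientGroup.mk' N)) : Set (Γ ⧸ N))) (QuotientGroup.mk' N g) := by
  convert criticalProb_lt (QuotientGroup.mk' N) (QuotientGroup.mk'_surjective N) (by rwa [QuotientGroup.ker_mk']) S hS g hpc using 6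

/-- **SITE twin of the normal-subgroup spelling.** [cite: BenjaminiSchramm1996, Question 1] [cite: MartineauSevero2019, Cor. 2.2 (site)] -/
theorem siteCriticalProb_lt_quotientGroup (N : Subgroup Γ) [N.Normal] (hN : N ≠ ⊥) (S : Finset Γ) (hS : Subgroup.closure (↑S : Set Γ) = ⊤)
    (g : Γ) (hpc : siteCriticalProb (mulCayley (↑S : Set Γ)) g < 1) :
    siteCriticalProb (mulCayley (↑S : Set Γ)) g <
      siteCriticalProb (mulCayley (↑(S.image (QuotientGroup.mk' N)) : Set (Γ ⧸ N))) (QuotientGroup.mk' N g) := by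
  convert siteCriticalProb_lt (QuotientGroup.mk' N) (QuotientGroup.mk'_surjective N) (by rwa [QuotientGroup.ker_mk']) S hS g hpc using 6

end CayleyQuot

end Summit.CriticalPhenomena.PercolationContinuityZ3.Theorems.Transplant

end
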